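import Literature.MathematicalPhysics.QuantumFieldTheory.Balaban1983to89.Node00.DomainsRefinement
import Literature.MathematicalPhysics.QuantumFieldTheory.Balaban1983to89.Node00.CriticalOnFibre
import Literature.MathematicalPhysics.QuantumFieldTheory.Balaban1983to89.T4ReflectionConeSharp

/-!
# NODE 00 — REFINING A (2.3) DOMAIN FAMILY SHRINKS THE NONLINEAR FIBRE: `Ω′_j ⊆ Ω_j` levelwise ⇒ `{U | Ū = Ū(U₀) on the cells of D′} ⊆ {U | Ū = Ū(U₀) on the cells of D}`
# for Bałaban's (0.4) block averaging; hence print's curve-criticality on the `D`-fibre passes to the `D′`-fibre ([15] p.301 «more restrictive functional conditions»)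

Cell `pub-ymgap`, seat `pub-ymgap-dag-n07-e` g29 (FAN-OUT §N07 row s3; LANE OWNER of the K0 road chart side), MODULE 101 = repair (R2)(a) of the located item
⚑ LOCATED-DPRIME-CALIBRATION (desk memo, 2026-08-29): the NONLINEAR twin of the seat's MODULE 44A `Node00/DomainsRefinement` (`constrZero_of_domainsLe`, linear∕flat form).
`--kind proof --supports stmt-QuantumFields-20541` (K0⁷; count-neutral; theorems only, no definition).  [15] = [Balaban1985Variational]; [B6] = [Balaban1984PropagatorsII];
[I] = [Balaban1987RG1]; [III] = [Balaban1988Convergent].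

WHY.  [15] p. 301: «U′_k is a minimum of the functional (5) in the space (6) …, hence it is a minimum of this functional in the space (150), because this space is defined by more
restrictive functional conditions».  In the tree's letters: (150) is a (2.3) family `D′` ([B6] (2.1)–(2.3), `B6SectADomainsV1.Domains`) that REFINES the family `D` of (6)
(`∀ j, D′.Om j ⊆ D.Om j`, MODULE 44A's order), and «more restrictive» is the SET inclusion of the nonlinear fibres: if `Ū^i(U)(c) = Ū^i(U₀)(c)` at every `D′`-indexed bond then the same
holds at every `D`-indexed bond.  MODULE 44A proved the flat∕linear shadow (`Q_{D′}A = 0 ⇒ Q_DA = 0`); this file proves the statement print uses, for the GROUP-valued iterated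
averages `avgFamily av U = (M^i(U))_i` of [III] (2.11), for every averaging family with the TWO-BLOCK LOCALITY of [I] (0.4) — the `(i+1)`-average at `c` reads the `i`-field only on bonds
with BOTH end points in `B(c₋) ∪ B(c₊)` (§1: the (0.4) loops `Γ ∪ [x,x′] ∪ (−Γ′) ∪ (−c)` never leave the two blocks — the tree's `T4ReflectionConeSharp.avgFun_congr₂`).  The induction (§2) is on the level: an `i`-bond with NO `D′`-deep end point is either
`D′`-indexed, or has both end blocks outside `Ω′_i`, and then every `(i−1)`-bond feeding its average has both end blocks outside `Ω′_i`, i.e. no `D′`-deep end point.  §3 draws the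
consequence for print's criticality in the curve form of `Node00.IsCritOnFibre` on (2.3) fibres (the `critLam` shape of `…N07CritMultiScaleLamBond` ∕ `…Converse`): critical along every
curve in the `D`-fibre ⇒ critical along every curve in the `D′`-fibre — the step a per-cube transfer of the K0 road's (d′) in-edge needs at the meet family
`cubeDomains ⊓ domainsOfSeq ≤ domainsOfSeq` (MODULE 44B∕44C).

WHAT IS PROVED (sorry-free; no definition; axioms standard).
§1 is the tree's two-block locality of `blockAvg ℰ` (`T4ReflectionConeSharp.avgFun_congr₂`, cited by name).  §2 ★★ `iter_eq_of_not_deep` (for a family `av` with two-block locality: agreement of `M^i(V)`, `M^i(V′)` on the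
`D′`-indexed bonds ⇒ agreement at every `i`-bond with no `D′`-deep end point, `i ≤ m + K`), ★★★ `iter_eq_on_lamBond_of_domainsLe` (`D′ ≤ D` ⇒ agreement on the `D`-indexed bonds),
`avgFun_twoBlockLocal_blockAvg` (the hypothesis for `blockAvg ℰ`, hence for `Node00.avOfRecord`).  §3 at NODE 00's objects: ★★★ `critLam_of_domainsLe` (curve-critical on the `D`-fibre of
`W` ⇒ curve-critical on the `D′`-fibre of `Ū(U)`), `agreeOnLam_avOfRecord_of_domainsLe`.
HONEST FRAMING: lattice bookkeeping over the tree's (0.4) loops and [B6] (2.3); NOTHING of [15]'s estimates asserted; the reading seam (b)∕(ii) of the K0 road is NOT touched here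
(this file lives entirely in the (2.3) `LamBond` world); K0⁷ NOT closed; N07 NOT discharged; counts unmoved; one finite 𝕋⁴ programme at fixed ε — NOT continuum ∕ ℝ⁴ ∕ OS ∕ mass gap ∕
Clay.  No `sorry`, no `def`, no `instance`, no `notation`.

References: [15] (5)–(6) p.278, (150) p.301, Prop. 8 p.304; [B6] (2.1)–(2.3) p.224, (2.20) p.226; [I] (0.3)–(0.4) pp.252–253, (0.11) p.253; [III] (2.10)–(2.12) p.256.
-/

noncomputable section

namespace Literature.MathematicalPhysics.QuantumFieldTheory.Balaban1983to89.Node00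

open Filter Topology
open T4Continuum BlockAveraging AveragingRT
open B6SectADomainsV1 (Domains)
open B15DeterminingSets (avgFamily)

/-! ## §1  Two-block locality of the (0.4) block averaging — IN THE TREE: `T4ReflectionConeSharp.blockOf_tgt_of_mem_walk` ∕ `loopHol_congr₂` ∕ `axialAvg_congr₂` ∕
`avgFun_congr₂` (agreement on the bonds with BOTH end blocks in `{c₋, c₊}` suffices); imported and cited by name, not restated. -/

/-! ## §2  Refinement shrinks the nonlinear fibre -/

section Refinement

variable {P : Params} {G : Type*} [GaugeGroup G]

/-- ★★ **AGREEMENT ON THE `D′`-INDEXED BONDS PROPAGATES TO EVERY BOND WITH NO `D′`-DEEP END POINT** (standing range `i ≤ m + K`), for any averaging family with two-block locality: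
an `i`-bond with no deep end point is either `D′`-indexed (one end in `Ω′_i`) or has both end blocks outside `Ω′_i^{(i)}`, and then (for `i ≥ 1`) every `(i−1)`-bond feeding its
average has both end `i`-blocks in `{c₋, c₊}`, hence no `D′`-deep end point — induction on `i`. [cite: Balaban1984PropagatorsII, (2.3) p.224, (2.20) p.226; Balaban1987RG1, (0.11) p.253] -/
theorem iter_eq_of_not_deep (av : ∀ j, Averaging P j G)
    (hloc : ∀ (j : ℕ), j + 1 ≤ P.m + P.K → ∀ (U U' : GaugeField P j G) (c : PBond P (j + 1)),
      (∀ b : PBond P j, (blockOf b.src = c.src ∨ blockOf b.src = c.tgt) → (blockOf b.tgt = c.src ∨ blockOf b.tgt = c.tgt) → U b = U' b) →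
        (av j).avg U c = (av j).avg U' c)
    (D' : Domains P) {V V' : GaugeField P 0 G}
    (hV : ∀ (i : ℕ) (c : PBond P i), D'.LamBond i c → Averaging.iter av i V c = Averaging.iter av i V' c) :
    ∀ (i : ℕ), i ≤ P.m + P.K → ∀ c : PBond P i, ¬ D'.Deep i c.src → ¬ D'.Deep i c.tgt →
      Averaging.iter av i V c = Averaging.iter av i V' c := by
  intro i
  induction i with
  | zero =>
    intro _ c hs ht
    exact hV 0 c ⟨Or.inl (by rw [D'.Om_zero]; exact Finset.mem_univ _), hs, ht⟩
  | succ i ih =>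
    intro hi c hs ht
    by_cases hmem : c.src ∈ D'.Om (i + 1) ∨ c.tgt ∈ D'.Om (i + 1)
    · exact hV (i + 1) c ⟨hmem, hs, ht⟩
    · push Not at hmem
      show (av i).avg (Averaging.iter av i V) c = (av i).avg (Averaging.iter av i V') c
      refine hloc i hi _ _ c fun b hbs hbt => ih (by omega) b ?_ ?_
      · show blockOf b.src ∉ D'.Om (i + 1)
        rcases hbs with h | h <;> rw [h]
        exacts [hmem.1, hmem.2]
      · show blockOf b.tgt ∉ D'.Om (i + 1)
        rcases hbt with h | h <;> rw [h]
        exacts [hmem.1, hmem.2]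

/-- ★★★ **REFINEMENT SHRINKS THE FIBRE** ([15] p. 301 «more restrictive functional conditions», nonlinear form): if `Ω′_j^{(j)} ⊆ Ω_j^{(j)}` for every `j` (MODULE 44A's order) and
the iterated averages of `V`, `V′` agree on every `D′`-indexed bond, then they agree on every `D`-indexed bond (the end points of a `D`-indexed bond are not `D′`-deep,
`not_deep_of_lamBond_of_domainsLe`; its level is `≤ k(D) ≤ m + K`). [cite: Balaban1985Variational, (150) p.301; Balaban1984PropagatorsII, (2.3) p.224] -/
theorem iter_eq_on_lamBond_of_domainsLe (av : ∀ j, Averaging P j G)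
    (hloc : ∀ (j : ℕ), j + 1 ≤ P.m + P.K → ∀ (U U' : GaugeField P j G) (c : PBond P (j + 1)),
      (∀ b : PBond P j, (blockOf b.src = c.src ∨ blockOf b.src = c.tgt) → (blockOf b.tgt = c.src ∨ blockOf b.tgt = c.tgt) → U b = U' b) →
        (av j).avg U c = (av j).avg U' c)
    {D' D : Domains P} (hle : ∀ j : ℕ, D'.Om j ⊆ D.Om j) {V V' : GaugeField P 0 G}
    (hV : ∀ (i : ℕ) (c : PBond P i), D'.LamBond i c → Averaging.iter av i V c = Averaging.iter av i V' c)
    {j : ℕ} (c : PBond P j) (hc : D.LamBond j c) : Averaging.iter av j V c = Averaging.iter av j V' c :=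
  have hnd := not_deep_of_lamBond_of_domainsLe hle hc
  iter_eq_of_not_deep av hloc D' hV j ((D.le_of_lamBond hc).trans D.hk) c hnd.1 hnd.2

/-- The two-block locality hypothesis holds for Bałaban's (0.4) block averaging with any small-loop average `ℰ` (§1), at every level. [cite: Balaban1987RG1, (0.4) p.253] -/
theorem avgFun_twoBlockLocal_blockAvg (ℰ : LoopAverage G) :
    ∀ (j : ℕ), j + 1 ≤ P.m + P.K → ∀ (U U' : GaugeField P j G) (c : PBond P (j + 1)),
      (∀ b : PBond P j, (blockOf b.src = c.src ∨ blockOf b.src = c.tgt) → (blockOf b.tgt = c.src ∨ blockOf b.tgt = c.tgt) → U b = U' b) →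
        (blockAvg ℰ : Averaging P j G).avg U c = (blockAvg ℰ : Averaging P j G).avg U' c :=
  fun _ hj U U' c h => T4ReflectionConeSharp.avgFun_congr₂ ℰ hj U U' c h

end Refinement

/-! ## §3  At NODE 00's objects: print's curve-criticality passes to every finer (2.3) family -/

section Record

open T4Continuum (T4Family)

variable {F : T4Family} {N : ℕ} [NeZero N] {K : ℕ}

/-- **The averaging of record has two-block locality** (it is `blockAvg expMeanLogSU` at every level, `rfl`). [cite: Balaban1987RG1, (0.4) p.253] -/
theorem avOfRecord_twoBlockLocal :
    ∀ (j : ℕ), j + 1 ≤ (F.P K).m + (F.P K).K → ∀ (U U' : GaugeField (F.P K) j (SU N)) (c : PBond (F.P K) (j + 1)),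
      (∀ b : PBond (F.P K) j, (blockOf b.src = c.src ∨ blockOf b.src = c.tgt) → (blockOf b.tgt = c.src ∨ blockOf b.tgt = c.tgt) → U b = U' b) →
        (avOfRecord F N K j).avg U c = (avOfRecord F N K j).avg U' c :=
  fun j hj U U' c h => avgFun_twoBlockLocal_blockAvg ExpMeanLog.expMeanLogSU j hj U U' c h

/-- ★★ **AT THE RECORD: refinement shrinks the fibre of `avgFamily (avOfRecord F N K)`** — `Ω′_j ⊆ Ω_j` levelwise and agreement of `Ū(V)`, `Ū(V′)` on the `D′`-indexed bonds give
agreement on the `D`-indexed bonds. [cite: Balaban1985Variational, (150) p.301; Balaban1988Convergent, (2.11) p.256] -/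
theorem agreeOnLam_avOfRecord_of_domainsLe {D' D : Domains (F.P K)} (hle : ∀ j : ℕ, D'.Om j ⊆ D.Om j)
    {V V' : GaugeField (F.P K) 0 (SU N)}
    (hV : ∀ (i : ℕ) (c : PBond (F.P K) i), D'.LamBond i c → avgFamily (avOfRecord F N K) V i c = avgFamily (avOfRecord F N K) V' i c) :
    ∀ (j : ℕ) (c : PBond (F.P K) j), D.LamBond j c → avgFamily (avOfRecord F N K) V j c = avgFamily (avOfRecord F N K) V' j c :=
  fun _ c hc => iter_eq_on_lamBond_of_domainsLe (avOfRecord F N K) avOfRecord_twoBlockLocal hle hV c hc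

/-- ★★★ **PRINT'S CURVE-CRITICALITY PASSES TO EVERY FINER (2.3) FAMILY** ([15] p. 301: minimal∕critical in (6) ⇒ in (150)).  If `U` lies on the `D`-fibre of the datum `W`
(`Ū^j(U)(c) = W_j(c)` on the `D`-indexed bonds) and the derivative of the Wilson action vanishes along every curve through `U`, differentiable at `0` as a curve of bond matrices and
lying in that fibre for `t` near `0` (the `critLam` form of `…N07CritMultiScaleLamBond`), then the same holds along every such curve lying in the `D′`-fibre of `U`'s OWN averages,
for every levelwise-finer family `D′` (§2: near `t = 0` such a curve lies in the `D`-fibre of `W`). [cite: Balaban1985Variational, (5)–(6) p.278, (150) p.301, Prop. 8 p.304; Balaban1984PropagatorsII, (2.3) p.224] -/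
theorem critLam_of_domainsLe {D' D : Domains (F.P K)} (hle : ∀ j : ℕ, D'.Om j ⊆ D.Om j)
    {W : B15DeterminingSets.MSField (F.P K) (SU N)} {U : GaugeField (F.P K) 0 (SU N)}
    (hUW : ∀ (j : ℕ) (c : PBond (F.P K) j), D.LamBond j c → avgFamily (avOfRecord F N K) U j c = W j c)
    (hcrit : ∀ γ : ℝ → GaugeField (F.P K) 0 (SU N), γ 0 = U →
      DifferentiableAt ℝ (fun (t : ℝ) (b : PBond (F.P K) 0) => ((γ t b : SU N) : Matrix (Fin N) (Fin N) ℂ)) 0 →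
        (∀ᶠ t in 𝓝 (0 : ℝ), ∀ (j : ℕ) (c : PBond (F.P K) j), D.LamBond j c → avgFamily (avOfRecord F N K) (γ t) j c = W j c) →
          ∀ a : ℝ, HasDerivAt (fun t => wilsonAction4 (γ t)) a 0 → a = 0) :
    ∀ γ : ℝ → GaugeField (F.P K) 0 (SU N), γ 0 = U →
      DifferentiableAt ℝ (fun (t : ℝ) (b : PBond (F.P K) 0) => ((γ t b : SU N) : Matrix (Fin N) (Fin N) ℂ)) 0 →
        (∀ᶠ t in 𝓝 (0 : ℝ), ∀ (j : ℕ) (c : PBond (F.P K) j), D'.LamBond j c →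
          avgFamily (avOfRecord F N K) (γ t) j c = avgFamily (avOfRecord F N K) U j c) →
          ∀ a : ℝ, HasDerivAt (fun t => wilsonAction4 (γ t)) a 0 → a = 0 :=
  fun γ hγ0 hd hfib a ha => hcrit γ hγ0 hd
    (hfib.mono fun _ ht j c hc => (agreeOnLam_avOfRecord_of_domainsLe hle ht j c hc).trans (hUW j c hc)) a ha

end Record

end Literature.MathematicalPhysics.QuantumFieldTheory.Balaban1983to89.Node00

end
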